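import Mathlib
import HarnessLib
import Summits.Ventures.LatticeQCDFlow.Scoring.DoeblinSkeleton
import Summits.Ventures.LatticeQCDFlow.Scoring.ChainTimeAverage

/-!
# The `m`-skeleton error bar: a minorisation certified for a BLOCK of `m` updates gives
# `Var[(1/N) Σ_{i<N} f(X_i)] ≤ (2m/ε_m − 1) · Var_π f / N` in single-update units

HONEST FRAMING: exact (Metropolis-corrected) sampling algorithms for lattice gauge theory;
figures of merit are autocorrelation/cost numbers at stated couplings and volumes; no
continuum-physics claim.

Venture `LatticeQCDFlow` (cell pub-lqcd), topic `Scoring`; FANOUT row 8 (`s0-cpn-nemc`, GEN-13).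
NEW WORK of the cell, not a published result; no definition is introduced.  It composes two tree
files of the same row: the `m`-skeleton envelope of `Scoring/DoeblinSkeleton.lean`
(`|C_f(mq + r)| ≤ (1 − ε)^q Var_π f` when the `m`-step kernel `nHit κ m` is minorised by the
invariant law, and the comparison series `Σ_t x^{⌊t/m⌋}`) with THE BRIDGE of
`Scoring/ChainTimeAverage.lean` (for Mathlib's `Kernel.trajMeasure` of the chain started in `π`,
`cov[f(X_i), f(X_j)] = autocov κ π (f − πf) |i − j|` and row 11's
`Var[Σ_{i<N} X_i] = N C(0) + 2 Σ_{t<N} (N − t − 1) C(t+1)`, `Scoring/VarianceOfTheMean.lean`).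
Printed counterpart NAMED ONLY: the `m`-skeleton form of the Doeblin–Doob minorisation
(Meyn–Tweedie 1993 Thm 16.0.2; Rosenthal 1995); nothing is cited as a fact.

## Content (`κ` Markov with invariant probability law `π`; `m`-STEP DOEBLIN BY `π`:
## `(nHit κ m)(x, B) ≥ ε π(B)`, `ε > 0`, `m ≥ 1`; `f` bounded measurable; `P` = the trajectory law of
## the chain started in `π`)

* `abs_autocov_le_pow_div_of_doeblin_nHit` — the envelope at every lag in the shape used here:
  `|C_g(t)| ≤ (1 − ε)^{⌊t/m⌋} C_g(0)` for centred `g`;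
* `sum_range_pow_succ_div_le` — `Σ_{t<N} x^{⌊(t+1)/m⌋} ≤ m/(1 − x) − 1` (`0 ≤ x < 1`, `m ≥ 1`);
* **`variance_timeAverage_le_of_doeblin_nHit`** — THE `m`-SKELETON ERROR BAR: for every bounded
  measurable `f` and every `N ≥ 1`,
  `Var_P[(1/N) Σ_{i<N} f(X_i)] ≤ (2m/ε − 1) · Var_π f / N`
  (time counted in single applications of `κ`; `m = 1` is `Scoring.variance_timeAverage_le_of_doeblin`);
* `variance_timeAverage_le_of_doeblin_pow` — the same with the hypothesis on Mathlib's kernel power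
  `κ ^ m`; **`variance_timeAverage_le_exp_of_doeblin_nHit`** — with `ε = e^{−M}`:
  `≤ (2m e^{M} − 1) · Var_π f / N`.

Reading (value-free): a sampler whose single update minorises nothing (a site update of a sweep, one
leapfrog trajectory of a family, one layer) but whose block of `m` updates carries a certificate
`ε_m` has an honest, non-asymptotic error bar on every bounded observable's time average taken over
ALL `N` single updates — the block structure costs the factor `m` inside `2m/ε_m − 1` and nothing
else; no thinning to the skeleton is needed.  NOT CLAIMED: any `ε_m` or `m` for a concrete sampler
(measured, or row 9's heat-bath minorisations); unbounded observables; the Γ-method estimator;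
non-stationary starts (the chain is started in `π`).
-/

noncomputable section

namespace Summit.Ventures.LatticeQCDFlow.Scoring

open MeasureTheory ProbabilityTheory Filter Finset Preorder Summit.Ventures.LatticeQCDFlow.Exactness
open scoped ENNReal

variable {Ω : Type*} [MeasurableSpace Ω]

/-! ### The envelope at every lag and the partial sums of the comparison series -/

section Envelope

variable {κ : Kernel Ω Ω} [IsMarkovKernel κ] {π : Measure Ω} [IsProbabilityMeasure π] {ε : ℝ≥0∞}
  {m : ℕ}

/-- `|C_g(t)| ≤ (1 − ε)^{⌊t/m⌋} · C_g(0)` for a bounded measurable `π`-centred `g` under an `m`-step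
Doeblin constant (Lean's `t / m`). -/
theorem abs_autocov_le_pow_div_of_doeblin_nHit (hπ : Kernel.Invariant κ π)
    (hmin : ∀ x {B : Set Ω}, MeasurableSet B → ε * π B ≤ nHit κ m x B) {g : Ω → ℝ}
    (hg : Measurable g) {C : ℝ} (hC : ∀ x, |g x| ≤ C) (hg0 : ∫ x, g x ∂π = 0) (t : ℕ) :
    |autocov κ π g t| ≤ (1 - ε.toReal) ^ (t / m) * autocov κ π g 0 := by
  have h := abs_autocov_le_of_doeblin_nHit hπ hmin hg hC hg0 (t / m) (t % m)
  rw [Nat.div_add_mod] at h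
  rwa [autocov_zero]

end Envelope

section Series

variable {x : ℝ} {m : ℕ}

/-- `Σ_{t<N} x^{⌊(t+1)/m⌋} ≤ m/(1 − x) − 1` for `0 ≤ x < 1`, `m ≥ 1` (the `t = 0` term of
`Scoring.sum_range_pow_div_le` is `1`). -/
theorem sum_range_pow_succ_div_le (hm : 0 < m) (hx0 : 0 ≤ x) (hx1 : x < 1) (N : ℕ) :
    ∑ t ∈ range N, x ^ ((t + 1) / m) ≤ m / (1 - x) - 1 := by
  have h := sum_range_pow_div_le hm hx0 hx1 (N + 1)
  rw [Finset.sum_range_succ', Nat.zero_div, pow_zero] at h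
  linarith

end Series

/-! ### The `m`-skeleton error bar on the simulated chain -/

section Chain

variable {κ : Kernel Ω Ω} [IsMarkovKernel κ] {π : Measure Ω} [IsProbabilityMeasure π] {ε : ℝ≥0∞}
  {m : ℕ}

/-- **THE `m`-SKELETON ERROR BAR.**  Let `π` be an invariant probability law of the Markov kernel `κ`
whose `m`-step kernel satisfies `(nHit κ m)(x, B) ≥ ε π(B)` for all `x` and measurable `B`
(`ε > 0`, `m ≥ 1`).  Then for the chain `X_0, X_1, …` with kernel `κ` started in `π` (Mathlib's
`Kernel.trajMeasure`), every bounded measurable `f` and every `N ≥ 1`: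
`Var[(1/N) Σ_{i<N} f(X_i)] ≤ (2m/ε − 1) · Var_π f / N`. -/
theorem variance_timeAverage_le_of_doeblin_nHit (hπ : Kernel.Invariant κ π)
    (hmin : ∀ x {B : Set Ω}, MeasurableSet B → ε * π B ≤ nHit κ m x B) (hm : 0 < m) (hε0 : 0 < ε)
    {f : Ω → ℝ} (hf : Measurable f) {C : ℝ} (hC : ∀ x, |f x| ≤ C) {N : ℕ} (hN : N ≠ 0) :
    Var[fun x : ℕ → Ω => (∑ i ∈ Finset.range N, f (x i)) / N;
        Kernel.trajMeasure (X := fun _ : ℕ => Ω) π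
          (fun n : ℕ => κ.comap (fun h : (i : ↥(Finset.Iic n)) → Ω => h ⟨n, Finset.mem_Iic.2 le_rfl⟩)
            (measurable_pi_apply _))]
      ≤ (2 * m / ε.toReal - 1) * autocov κ π (fun y => f y - ∫ z, f z ∂π) 0 / N := by
  haveI := isMarkovKernel_nHit κ m
  set P := Kernel.trajMeasure (X := fun _ : ℕ => Ω) π
        (fun n : ℕ => κ.comap (fun h : (i : ↥(Finset.Iic n)) → Ω => h ⟨n, Finset.mem_Iic.2 le_rfl⟩)
          (measurable_pi_apply _)) with hP
  set g := fun y => f y - ∫ z, f z ∂π with hg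
  have hgm : Measurable g := hf.sub measurable_const
  have hgb : ∀ y, |g y| ≤ C + |∫ z, f z ∂π| := fun y =>
    (abs_sub _ _).trans (add_le_add (hC y) le_rfl)
  have hg0 : ∫ y, g y ∂π = 0 := by
    rw [hg, integral_sub (integrable_of_bounded π hf hC) (integrable_const _), integral_const,
      probReal_univ, one_smul, sub_self]
  have hε1 := eps_le_one_of_doeblin hmin
  have hεr0 : 0 < ε.toReal :=
    ENNReal.toReal_pos hε0.ne' (ne_top_of_le_ne_top ENNReal.one_ne_top hε1)
  have hl0 : 0 ≤ 1 - ε.toReal := one_sub_toReal_nonneg_of_doeblin hmin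
  have hl1 : 1 - ε.toReal < 1 := by linarith
  have hσ0 : 0 ≤ autocov κ π g 0 := by rw [autocov_zero]; exact integral_nonneg fun _ => sq_nonneg _
  have henv : ∀ t, |autocov κ π g t| ≤ (1 - ε.toReal) ^ (t / m) * autocov κ π g 0 := fun t =>
    abs_autocov_le_pow_div_of_doeblin_nHit hπ hmin hgm hgb hg0 t
  have hsum : Var[fun x : ℕ → Ω => ∑ i ∈ Finset.range N, f (x i); P]
      = N * autocov κ π g 0
          + 2 * ∑ t ∈ Finset.range N, ((N : ℝ) - (t + 1)) * autocov κ π g (t + 1) := by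
    have h := variance_sum_range_of_cov_eq (μ := P) (fun i x => f (x i)) (autocov κ π g) N
      (fun i _ => by rw [hP]; exact chain_memLp π hf hC i)
      (fun i _ j _ => by rw [hP]; exact chain_covariance hπ hf hC i j)
    rw [← h]
    congr 1
    funext x
    rw [Finset.sum_apply]
  have hNpos : (0 : ℝ) < N := by exact_mod_cast Nat.pos_of_ne_zero hN
  have hlag : ∑ t ∈ Finset.range N, ((N : ℝ) - (t + 1)) * autocov κ π g (t + 1)
      ≤ N * ((m / ε.toReal - 1) * autocov κ π g 0) := by
    have hterm : ∀ t ∈ Finset.range N, ((N : ℝ) - (t + 1)) * autocov κ π g (t + 1)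
        ≤ N * ((1 - ε.toReal) ^ ((t + 1) / m) * autocov κ π g 0) := by
      intro t ht
      have ht' : (t : ℝ) + 1 ≤ N := by exact_mod_cast Finset.mem_range.1 ht
      have h1 : ((N : ℝ) - (t + 1)) * autocov κ π g (t + 1)
          ≤ ((N : ℝ) - (t + 1)) * |autocov κ π g (t + 1)| :=
        mul_le_mul_of_nonneg_left (le_abs_self _) (by linarith)
      have h2 : ((N : ℝ) - (t + 1)) * |autocov κ π g (t + 1)| ≤ N * |autocov κ π g (t + 1)| :=
        mul_le_mul_of_nonneg_right (by linarith) (abs_nonneg _)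
      exact h1.trans (h2.trans (mul_le_mul_of_nonneg_left (henv (t + 1)) hNpos.le))
    refine (Finset.sum_le_sum hterm).trans ?_
    rw [← Finset.mul_sum, ← Finset.sum_mul]
    refine mul_le_mul_of_nonneg_left (mul_le_mul_of_nonneg_right ?_ hσ0) hNpos.le
    have hs := sum_range_pow_succ_div_le (x := 1 - ε.toReal) hm hl0 hl1 N
    rwa [sub_sub_cancel] at hs
  have hdiv : (fun x : ℕ → Ω => (∑ i ∈ Finset.range N, f (x i)) / N)
      = fun x => (∑ i ∈ Finset.range N, f (x i)) * (N : ℝ)⁻¹ := by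
    funext x; rw [div_eq_mul_inv]
  rw [hdiv, variance_mul_const, hsum]
  rw [show (2 * m / ε.toReal - 1) * autocov κ π g 0 / N
      = (N * autocov κ π g 0 + 2 * (N * ((m / ε.toReal - 1) * autocov κ π g 0))) * ((N : ℝ)⁻¹) ^ 2 by
    field_simp; ring]
  exact mul_le_mul_of_nonneg_right (by linarith) (sq_nonneg _)

/-- The same with the hypothesis written on Mathlib's kernel power: `(κ ^ m)(x, ·) ≥ ε π`. -/
theorem variance_timeAverage_le_of_doeblin_pow (hπ : Kernel.Invariant κ π)
    (hmin : ∀ x {B : Set Ω}, MeasurableSet B → ε * π B ≤ (κ ^ m) x B) (hm : 0 < m) (hε0 : 0 < ε)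
    {f : Ω → ℝ} (hf : Measurable f) {C : ℝ} (hC : ∀ x, |f x| ≤ C) {N : ℕ} (hN : N ≠ 0) :
    Var[fun x : ℕ → Ω => (∑ i ∈ Finset.range N, f (x i)) / N;
        Kernel.trajMeasure (X := fun _ : ℕ => Ω) π
          (fun n : ℕ => κ.comap (fun h : (i : ↥(Finset.Iic n)) → Ω => h ⟨n, Finset.mem_Iic.2 le_rfl⟩)
            (measurable_pi_apply _))]
      ≤ (2 * m / ε.toReal - 1) * autocov κ π (fun y => f y - ∫ z, f z ∂π) 0 / N := by
  rw [← nHit_eq_pow] at hmin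
  exact variance_timeAverage_le_of_doeblin_nHit hπ hmin hm hε0 hf hC hN

/-- **`Var[(1/N) Σ_{i<N} f(X_i)] ≤ (2m e^{M} − 1) · Var_π f / N`** — the `m`-skeleton error bar with
the block constant written `e^{−M}` (the shape in which log-weight / action-difference oscillation
bounds deliver a minorisation). -/
theorem variance_timeAverage_le_exp_of_doeblin_nHit (hπ : Kernel.Invariant κ π) {M : ℝ}
    (hmin : ∀ x {B : Set Ω}, MeasurableSet B →
      ENNReal.ofReal (Real.exp (-M)) * π B ≤ nHit κ m x B) (hm : 0 < m)
    {f : Ω → ℝ} (hf : Measurable f) {C : ℝ} (hC : ∀ x, |f x| ≤ C) {N : ℕ} (hN : N ≠ 0) :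
    Var[fun x : ℕ → Ω => (∑ i ∈ Finset.range N, f (x i)) / N;
        Kernel.trajMeasure (X := fun _ : ℕ => Ω) π
          (fun n : ℕ => κ.comap (fun h : (i : ↥(Finset.Iic n)) → Ω => h ⟨n, Finset.mem_Iic.2 le_rfl⟩)
            (measurable_pi_apply _))]
      ≤ (2 * m * Real.exp M - 1) * autocov κ π (fun y => f y - ∫ z, f z ∂π) 0 / N := by
  have h := variance_timeAverage_le_of_doeblin_nHit hπ hmin hm
    (ENNReal.ofReal_pos.2 (Real.exp_pos _)) hf hC hN
  have h1 : 2 * (m : ℝ) / (ENNReal.ofReal (Real.exp (-M))).toReal = 2 * m * Real.exp M := by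
    rw [ENNReal.toReal_ofReal (Real.exp_pos _).le, Real.exp_neg, div_inv_eq_mul]
  rw [h1] at h
  exact h

end Chain

end Summit.Ventures.LatticeQCDFlow.Scoring

end
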